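import Literature.Combinatorics.Sahi2008.ProvedCases

/-!
# `NoHeavyLowerTail` (crux stmt-CriticalPhenomena-4575), Sahi programme: **THE QUANTITATIVE `C₃` FOR THREE PRINCIPAL UP-SETS HOLDS FOR
# EVERY FKG WEIGHT** — `2·E₃(χ_{↑a}, χ_{↑b}, χ_{↑c}) ≥ μ(↑a ∩ ↑b ∩ ↑c) − μ(↑a)μ(↑b)μ(↑c)` on every finite distributive lattice

Support file (Sahi cell, seat `prim-sahi-p1`, generation 48; `--supports stmt-CriticalPhenomena-4575`).  Pure proofs, NO definitions, no
`sorry`, standard axioms.  Companion of `…SahiQuantC3Principal` (same seat and generation), which proves the product-measure / grid case with an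
explicit slack term by a coordinatewise induction; this file removes the product hypothesis by a seven-number argument.

THE QUESTION (prim-sahi-p2 gen 33, memo FROM-prim-sahi-p2-gen33-TWO-LEVEL-ORACLE §8): a 'quantitative `C₃`' `E₃(f,g,h) ≥ κ·(M_123 − M_1M_2M_3)`
for principal up-sets?  ANSWER: **`κ = ½`, for every FKG (nonnegative log-supermodular) probability weight `μ` on a finite distributive
lattice `α` and all `a, b, c ∈ α`** (`two_mul_latticeE3_principal_ge`, function form `two_mul_sahiE_three_principal_ge`); `½` is sharp
(`…SahiQuantC3Principal.two_mul_latticeE3_self_sub`: for `↑a = ↑b = ↑c` of mass `s` the slack is exactly `3s(1−s)²`), and `κ = 1` (the shape of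
the percolation target K_avg) fails.  For unions of principal up-sets no `κ > 0` works (p2 gen 4).

PROOF (`core7`).  Put `T = μ(↑a∩↑b∩↑c)`, `P = μ(↑a)μ(↑b)μ(↑c)`, and `x = μ(↑a)μ(↑b∩↑c)`, `y = μ(↑b)μ(↑a∩↑c)`, `z = μ(↑c)μ(↑a∩↑b)`, so that
`2E₃ − (T − P) = 3T + 3P − 2(x+y+z)`.  Harris (`fkg_upperSet_mass`) gives `x, y, z ≤ T` and `P ≤ T`; Harris CONDITIONED ON A PRINCIPAL UP-SET
(`fkg_upperSet_mass_principal`, Blinovsky's device: `μ` restricted to `↑c` is again log-supermodular) gives `μ(↑b∩↑c)μ(↑a∩↑c) ≤ μ(↑c)·T`, i.e.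
`xy ≤ PT`, and likewise `xz, yz ≤ PT`.  ELEMENTARY LEMMA: `0 ≤ P ≤ T`, `0 ≤ x,y,z ≤ T`, pairwise products `≤ PT` ⟹ `2(x+y+z) ≤ 3(T+P)` (if the
largest, say `x`, is `≤ (T+P)/2` then the sum is `≤ 3x`; otherwise `y, z ≤ PT/x` and `x + 2PT/x ≤ 3(T+P)/2` on `[(T+P)/2, T]`).  Three principal
slots are needed exactly for the three conditional Harris inequalities.  (Sahi's `C₃` itself for ONE principal slot, `κ = 0`, is the tree's
`latticeE3_nonneg_of_principal`.) [this work]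
-/

namespace Summit.CriticalPhenomena.PercolationContinuityZ3.Theorems.SahiQuantC3

open Finset Literature.Probability.LatticeModels Literature.Combinatorics.Sahi2008
open scoped BigOperators

noncomputable section

/-! ### The seven-number lemma -/

section Core

/-- The elementary lemma with the largest variable named: `y, z ≤ x`. [this work] -/
theorem core7_of_max {P T x y z : ℝ} (hP : 0 ≤ P) (hPT : P ≤ T) (hy : 0 ≤ y) (hz : 0 ≤ z) (hxT : x ≤ T)
    (hyx : y ≤ x) (hzx : z ≤ x) (hxy : x * y ≤ P * T) (hxz : x * z ≤ P * T) : 2 * (x + y + z) ≤ 3 * T + 3 * P := by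
  by_cases h : 2 * x ≤ T + P
  · linarith
  · have h' : T + P < 2 * x := lt_of_not_ge h
    have h1 : 0 ≤ (2 * x - T - P) * (T - x) := mul_nonneg (by linarith) (by linarith)
    have h2 : 0 ≤ P * (2 * x - T - P) := mul_nonneg hP (by linarith)
    nlinarith [h1, h2, sq_nonneg (T - P), hxy, hxz]

/-- **The seven-number lemma.**  `0 ≤ P ≤ T`, `0 ≤ x, y, z ≤ T` and `xy, xz, yz ≤ PT` imply `2(x+y+z) ≤ 3T + 3P`. [this work] -/
theorem core7 {P T x y z : ℝ} (hP : 0 ≤ P) (hPT : P ≤ T) (hx : 0 ≤ x) (hy : 0 ≤ y) (hz : 0 ≤ z) (hxT : x ≤ T) (hyT : y ≤ T)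
    (hzT : z ≤ T) (hxy : x * y ≤ P * T) (hxz : x * z ≤ P * T) (hyz : y * z ≤ P * T) : 2 * (x + y + z) ≤ 3 * T + 3 * P := by
  rcases le_total y x with hyx | hxy'
  · rcases le_total z x with hzx | hxz'
    · exact core7_of_max hP hPT hy hz hxT hyx hzx hxy hxz
    · -- `z` is the largest
      have h := core7_of_max hP hPT hx hy hzT hxz' (hyx.trans hxz') (by rw [mul_comm]; exact hxz) (by rw [mul_comm]; exact hyz)
      linarith
  · rcases le_total z y with hzy | hyz'
    · -- `y` is the largest
      have h := core7_of_max hP hPT hx hz hyT hxy' hzy (by rw [mul_comm]; exact hxy) hyz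
      linarith
    · -- `z` is the largest
      have h := core7_of_max hP hPT hx hy hzT (hxy'.trans hyz') hyz' (by rw [mul_comm]; exact hxz) (by rw [mul_comm]; exact hyz)
      linarith

end Core

/-! ### Three principal up-sets under an FKG weight -/

section Lattice

variable {α : Type*} [DistribLattice α] [Fintype α] [DecidableEq α] [DecidableLE α]

/-- **THE QUANTITATIVE `C₃` FOR THREE PRINCIPAL UP-SETS, EVERY FKG WEIGHT (`κ = ½`).**  For a nonnegative log-supermodular weight `μ`
of total mass `1` on a finite distributive lattice and `a, b, c ∈ α`, with `A = ↑a`, `B = ↑b`, `C = ↑c`: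
`μ(A∩B∩C) − μ(A)μ(B)μ(C) ≤ 2 · latticeE3 μ A B C` (`= 2·E₃(χ_A,χ_B,χ_C)`). [this work] -/
theorem two_mul_latticeE3_principal_ge {μ : α → ℝ} (hμ₀ : 0 ≤ μ) (hμ : ∀ p q, μ p * μ q ≤ μ (p ⊓ q) * μ (p ⊔ q))
    (hZ : mass μ univ = 1) (a b c : α) :
    mass μ (principalUp a ∩ principalUp b ∩ principalUp c)
        - mass μ (principalUp a) * mass μ (principalUp b) * mass μ (principalUp c) ≤
      2 * latticeE3 μ (principalUp a) (principalUp b) (principalUp c) := by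
  have hA := isUpperSet_principalUp (α := α) a
  have hB := isUpperSet_principalUp (α := α) b
  have hC := isUpperSet_principalUp (α := α) c
  have hAB : IsUpperSet ((principalUp a ∩ principalUp b : Finset α) : Set α) := by
    rw [Finset.coe_inter]; exact hA.inter hB
  have hAC : IsUpperSet ((principalUp a ∩ principalUp c : Finset α) : Set α) := by
    rw [Finset.coe_inter]; exact hA.inter hC
  have hBC : IsUpperSet ((principalUp b ∩ principalUp c : Finset α) : Set α) := by
    rw [Finset.coe_inter]; exact hB.inter hC
  -- names
  set mA := mass μ (principalUp a) with hmA
  set mB := mass μ (principalUp b) with hmB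
  set mC := mass μ (principalUp c) with hmC
  set mAB := mass μ (principalUp a ∩ principalUp b) with hmAB
  set mAC := mass μ (principalUp a ∩ principalUp c) with hmAC
  set mBC := mass μ (principalUp b ∩ principalUp c) with hmBC
  set T := mass μ (principalUp a ∩ principalUp b ∩ principalUp c) with hT
  have hmA0 : 0 ≤ mA := mass_nonneg hμ₀ _
  have hmB0 : 0 ≤ mB := mass_nonneg hμ₀ _
  have hmC0 : 0 ≤ mC := mass_nonneg hμ₀ _
  have hmAB0 : 0 ≤ mAB := mass_nonneg hμ₀ _
  have hmAC0 : 0 ≤ mAC := mass_nonneg hμ₀ _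
  have hmBC0 : 0 ≤ mBC := mass_nonneg hμ₀ _
  have hT0 : 0 ≤ T := mass_nonneg hμ₀ _
  -- Harris: `x, y, z ≤ T`, `mA mB ≤ mAB`, `mAB mC ≤ T`
  have hx : mA * mBC ≤ T := by
    have h := fkg_upperSet_mass hμ₀ hμ hA hBC
    rw [hZ, one_mul, ← Finset.inter_assoc] at h; exact h
  have hy : mB * mAC ≤ T := by
    have h := fkg_upperSet_mass hμ₀ hμ hB hAC
    rw [hZ, one_mul, Finset.inter_left_comm, ← Finset.inter_assoc] at h; exact h
  have hz : mC * mAB ≤ T := by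
    have h := fkg_upperSet_mass hμ₀ hμ hC hAB
    have e : principalUp c ∩ (principalUp a ∩ principalUp b) = principalUp a ∩ principalUp b ∩ principalUp c :=
      Finset.inter_comm _ _
    rw [hZ, one_mul, e] at h; exact h
  have hab : mA * mB ≤ mAB := by
    have h := fkg_upperSet_mass hμ₀ hμ hA hB
    rw [hZ, one_mul] at h; exact h
  have hPT : mA * mB * mC ≤ T := by
    calc mA * mB * mC ≤ mAB * mC := mul_le_mul_of_nonneg_right hab hmC0
      _ = mC * mAB := mul_comm _ _
      _ ≤ T := hz
  -- conditional Harris on the principal up-sets: pairwise products `≤ P·T`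
  have hcond_c : mBC * mAC ≤ mC * T := by
    have h := fkg_upperSet_mass_principal hμ₀ hμ hB hA c
    -- h : mass (↑b ∩ ↑c) * mass (↑a ∩ ↑c) ≤ mass ↑c * mass (↑b ∩ ↑a ∩ ↑c)
    have e : principalUp b ∩ principalUp a ∩ principalUp c = principalUp a ∩ principalUp b ∩ principalUp c := by
      rw [Finset.inter_comm (principalUp b) (principalUp a)]
    rw [e] at h; exact h
  have hcond_b : mBC * mAB ≤ mB * T := by
    have h := fkg_upperSet_mass_principal hμ₀ hμ hC hA b
    -- h : mass (↑c ∩ ↑b) * mass (↑a ∩ ↑b) ≤ mass ↑b * mass (↑c ∩ ↑a ∩ ↑b)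
    have e1 : principalUp c ∩ principalUp b = principalUp b ∩ principalUp c := Finset.inter_comm _ _
    have e2 : principalUp c ∩ principalUp a ∩ principalUp b = principalUp a ∩ principalUp b ∩ principalUp c := by
      rw [Finset.inter_comm (principalUp c) (principalUp a), Finset.inter_assoc, Finset.inter_comm (principalUp c) (principalUp b),
        ← Finset.inter_assoc]
    rw [e1, e2] at h; exact h
  have hcond_a : mAC * mAB ≤ mA * T := by
    have h := fkg_upperSet_mass_principal hμ₀ hμ hC hB a
    -- h : mass (↑c ∩ ↑a) * mass (↑b ∩ ↑a) ≤ mass ↑a * mass (↑c ∩ ↑b ∩ ↑a)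
    have e1 : principalUp c ∩ principalUp a = principalUp a ∩ principalUp c := Finset.inter_comm _ _
    have e2 : principalUp b ∩ principalUp a = principalUp a ∩ principalUp b := Finset.inter_comm _ _
    have e3 : principalUp c ∩ principalUp b ∩ principalUp a = principalUp a ∩ principalUp b ∩ principalUp c := by
      rw [Finset.inter_comm (principalUp c) (principalUp b), Finset.inter_comm _ (principalUp a), ← Finset.inter_assoc]
    rw [e1, e2, e3] at h; exact h
  have hxy : (mA * mBC) * (mB * mAC) ≤ (mA * mB * mC) * T := by
    have h := mul_le_mul_of_nonneg_left hcond_c (mul_nonneg hmA0 hmB0)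
    nlinarith [h]
  have hxz : (mA * mBC) * (mC * mAB) ≤ (mA * mB * mC) * T := by
    have h := mul_le_mul_of_nonneg_left hcond_b (mul_nonneg hmA0 hmC0)
    nlinarith [h]
  have hyz : (mB * mAC) * (mC * mAB) ≤ (mA * mB * mC) * T := by
    have h := mul_le_mul_of_nonneg_left hcond_a (mul_nonneg hmB0 hmC0)
    nlinarith [h]
  have key := core7 (mul_nonneg (mul_nonneg hmA0 hmB0) hmC0) hPT (mul_nonneg hmA0 hmBC0) (mul_nonneg hmB0 hmAC0)
    (mul_nonneg hmC0 hmAB0) hx hy hz hxy hxz hyz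
  unfold latticeE3
  rw [hZ]
  nlinarith [key]

/-- **The same in Sahi's functional form**: for an FKG probability weight `μ` on a finite distributive lattice and principal up-sets
`A = ↑a`, `B = ↑b`, `C = ↑c`: `E[χ_Aχ_Bχ_C] − E[χ_A]E[χ_B]E[χ_C] ≤ 2·E₃^{μ}(χ_A,χ_B,χ_C)`. [this work] -/
theorem two_mul_sahiE_three_principal_ge {μ : α → ℝ} (hμ : IsFKGMeasure μ) (a b c : α) :
    mass μ (principalUp a ∩ principalUp b ∩ principalUp c)
        - mass μ (principalUp a) * mass μ (principalUp b) * mass μ (principalUp c) ≤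
      2 * sahiE μ 3 ![setInd (principalUp a), setInd (principalUp b), setInd (principalUp c)] := by
  rw [sahiE_three_indicator_eq_latticeE3 hμ.sum_eq_one]
  exact two_mul_latticeE3_principal_ge hμ.nonneg hμ.mul_le_mul (by rw [mass_univ]; exact hμ.sum_eq_one) a b c

end Lattice

end

end Summit.CriticalPhenomena.PercolationContinuityZ3.Theorems.SahiQuantC3
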